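import Summits.ValiantsHypothesis.ValiantsHypothesis.Theorems.GrenetZeonDualUnipotentThreeHalvesLongMassResolventFlag

/-!
# `GrenetZeon.DualUnipotentThreeHalves` (stmt-ValiantsHypothesis-24318), row r12 (RANK ROW) — part (G7b-1/3): the `s`-PENCIL, FLAG-BANDED matrices, `u`-coefficient DEGREES

Part 1 of 3 of the kernel proof of `rankRow_holds : RankRow` (part 3, `…LongMassRankRow`).  §P the `s`-pencil `pencilS A L = A + s•L` over `ℂ[s]`
(`SRing`) and pointwise ⇒ polynomial nilpotency (`pencilS_pow_eq_zero`, by `MvPolynomial.funext`); §A flag-banded ("admissible") matrices `Adm π q j`: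
the `s^e`-coefficient of entry `(i, i')` vanishes unless `e ≤ j` and `j + e·q + π i ≤ π i'` — closed under products with weights adding (`adm_mul`,
`adm_pow`), hence a weight-`1` banded `A'` has `A'^b = 0` (`eq_zero_of_adm`) and `deg_s` of every entry of `A'^j` is `≤ ⌊(b-1)/(q+1)⌋`
(`totalDegree_le_of_adm`: the r2 gap count), and the pencil `A₀ + s•L` with `A₀` strictly `π`-upper and `L` of `π`-gaps `> q` is banded of weight 1
(`adm_pencilS`); §B `DegLE d Z`: every `u`-coefficient of every entry of `Z ∈ M_b(ℂ[s][u])` has `s`-degree `≤ d` — closed under `+`, `Σ`, `*` (degrees add),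
powers, `u•`, and `u^a • (A.map C)` for `A` with entries of degree `≤ d` (`degLE_X_pow_smul_map_C`).

HONEST FRAMING (crit-7 V49/V67/V70 words stand): the rank row is a CALIBRATION row (r12), now a theorem — it prices the locus «triangular in one
constant flag up to a skew part of bounded rank» at `c = 2√(r+2)` (+ `σ/(b√n)`); it is NOT progress on the research stub (c) `SlowCore.LongMassSlowLawInv`;
24318 / S3 / R2ᵖ OPEN; `VP ≠ VNP` is NOT proved.  Helper (`--supports stmt-ValiantsHypothesis-24318`, helper mode); no instances, no notation, no named
facts.  STAGED PORT bytes by val-idea-29 g9 of `Cruxes/DualUnipotentThreeHalves/RankRow.lean` REV 2.1 @4cc029748180 §3 (this lineage never proposes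
Theorems; a prover seat presses on the critic's GO).  Credit: val-idea-29 g8 (row, identities), g9 (proof). [folklore]
-/

set_option linter.dupNamespace false
set_option autoImplicit false

namespace Summit.ValiantsHypothesis.ValiantsHypothesis.Theorems.GrenetZeon.RankRow

noncomputable section

open MvPolynomial Matrix
open scoped BigOperators Polynomial
open Finset (range)
open Summit.ValiantsHypothesis.ValiantsHypothesis.Theorems.GrenetZeon.ResolventFlag (SRing cst)

/-! ## §P The `s`-pencil `A + s·L` of two complex matrices -/

section Pencil
variable {b : ℕ}

/-- `A + s·L` as a matrix over `ℂ[s]` (`s = X 0`). -/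
def pencilS (A L : Matrix (Fin b) (Fin b) ℂ) : Matrix (Fin b) (Fin b) SRing :=
  A.map C + (X 0 : SRing) • L.map C

/-- Evaluating the pencil at `s = y 0` gives `A + (y 0)•L`. -/
theorem pencilS_map_eval (A L : Matrix (Fin b) (Fin b) ℂ) (y : Fin 1 → ℂ) :
    (pencilS A L).map (eval y) = A + y 0 • L := by
  ext i j
  simp [pencilS, Matrix.map_apply, Matrix.add_apply, Matrix.smul_apply]

/-- Powers of the pencil commute with evaluation at `s = y 0`. -/
theorem pencilS_pow_map_eval (A L : Matrix (Fin b) (Fin b) ℂ) (y : Fin 1 → ℂ) (k : ℕ) :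
    ((pencilS A L) ^ k).map (eval y) = (A + y 0 • L) ^ k := by
  rw [Matrix.map_pow (pencilS A L) (eval y : SRing →+* ℂ) k]
  change ((pencilS A L).map (eval y)) ^ k = _
  rw [pencilS_map_eval]

/-- Pointwise nilpotency along the line gives nilpotency over `ℂ[s]`. -/
theorem pencilS_pow_eq_zero (A L : Matrix (Fin b) (Fin b) ℂ) (k : ℕ)
    (h : ∀ s : ℂ, (A + s • L) ^ k = 0) : (pencilS A L) ^ k = 0 := by
  refine Matrix.ext fun i j => ?_
  apply MvPolynomial.funext
  intro y
  have h1 : eval y (((pencilS A L) ^ k) i j) = (((pencilS A L) ^ k).map (eval y)) i j := rfl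
  rw [h1, pencilS_pow_map_eval, h (y 0)]
  simp

end Pencil

/-! ## §A Admissible matrices over `ℂ[s]`: `s^e` in entry `(i,i')` only if `e ≤ j` and `j + e·q + π i ≤ π i'` -/

section Adm
variable {b : ℕ} (π : Equiv.Perm (Fin b)) (q : ℕ)

/-- Flag-banded of weight `j`: the `s^e`-coefficient of entry `(i, i')` vanishes unless `e ≤ j` and `j + e·q + π i ≤ π i'`. -/
def Adm (j : ℕ) (Y : Matrix (Fin b) (Fin b) SRing) : Prop :=
  ∀ (i i' : Fin b) (d : Fin 1 →₀ ℕ), coeff d (Y i i') ≠ 0 → d 0 ≤ j ∧ j + d 0 * q + (π i : ℕ) ≤ (π i' : ℕ)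

variable {π q}

/-- The identity is flag-banded of weight `0`. -/
theorem adm_one : Adm π q 0 (1 : Matrix (Fin b) (Fin b) SRing) := by
  intro i i' d hd
  rw [Matrix.one_apply] at hd
  by_cases hii : i = i'
  · subst hii
    rw [if_pos rfl, MvPolynomial.coeff_one] at hd
    by_cases hd0 : 0 = d
    · subst hd0; simp
    · rw [if_neg hd0] at hd; exact absurd rfl hd
  · rw [if_neg hii, coeff_zero] at hd; exact absurd rfl hd

/-- Flag-banded matrices multiply, adding their weights (the gap count adds up). -/
theorem adm_mul {j k : ℕ} {Y Z : Matrix (Fin b) (Fin b) SRing} (hY : Adm π q j Y) (hZ : Adm π q k Z) :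
    Adm π q (j + k) (Y * Z) := by
  classical
  intro i i' d hd
  rw [Matrix.mul_apply, coeff_sum] at hd
  obtain ⟨l, -, hl⟩ := Finset.exists_ne_zero_of_sum_ne_zero hd
  rw [coeff_mul] at hl
  obtain ⟨x, hx, hxne⟩ := Finset.exists_ne_zero_of_sum_ne_zero hl
  rw [Finset.HasAntidiagonal.mem_antidiagonal] at hx
  rcases mul_ne_zero_iff.1 hxne with ⟨h1, h2⟩
  obtain ⟨hY1, hY2⟩ := hY i l x.1 h1
  obtain ⟨hZ1, hZ2⟩ := hZ l i' x.2 h2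
  have hd' : d 0 = x.1 0 + x.2 0 := by rw [← hx]; rfl
  rw [hd', Nat.add_mul]
  constructor
  · omega
  · omega

/-- Powers of a weight-`1` flag-banded matrix: `Y ^ j` has weight `j`. -/
theorem adm_pow {Y : Matrix (Fin b) (Fin b) SRing} (hY : Adm π q 1 Y) (j : ℕ) : Adm π q j (Y ^ j) := by
  induction j with
  | zero => rw [pow_zero]; exact adm_one
  | succ j ih => rw [pow_succ]; exact adm_mul ih hY

/-- The pencil `A₀ + s·L` is admissible of weight `1` when `A₀` is strictly `π`-upper and `L` has `π`-gaps `> q`. -/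
theorem adm_pencilS (A₀ L : Matrix (Fin b) (Fin b) ℂ)
    (hA₀ : ∀ i i' : Fin b, π i' ≤ π i → A₀ i i' = 0)
    (hL : ∀ i i' : Fin b, (π i' : ℕ) ≤ (π i : ℕ) + q → L i i' = 0) :
    Adm π q 1 (pencilS A₀ L) := by
  classical
  intro i i' d hd
  simp only [pencilS, Matrix.add_apply, Matrix.smul_apply, Matrix.map_apply, smul_eq_mul, coeff_add, coeff_C,
    coeff_X_mul', coeff_C] at hd
  by_cases hd0 : 0 = d
  · subst hd0
    have hA : A₀ i i' ≠ 0 := by simpa using hd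
    have hlt : π i < π i' := by
      by_contra hle; exact hA (hA₀ i i' (not_lt.1 hle))
    have hlt' : (π i : ℕ) < (π i' : ℕ) := hlt
    simp; omega
  · rw [if_neg hd0, zero_add] at hd
    by_cases hs : (Finsupp.single (0 : Fin 1) 1 : Fin 1 →₀ ℕ) ≤ d
    · -- then the remaining coefficient is that of `C (L i i')` at `d - single 0 1`
      rw [if_pos (Finsupp.mem_support_iff.2 (by
        have : d 0 ≠ 0 := by
          intro h0
          have := hs 0
          simp [h0] at this
        simpa using this))] at hd
      by_cases hd1 : 0 = d - Finsupp.single (0 : Fin 1) 1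
      · rw [if_pos hd1] at hd
        have hLne : L i i' ≠ 0 := hd
        have hgap : (π i : ℕ) + q < (π i' : ℕ) := by
          by_contra hle; exact hLne (hL i i' (not_lt.1 hle))
        have hdeq : d 0 = 1 := by
          have h := congrArg (fun f : Fin 1 →₀ ℕ => f 0) hd1
          have h1 : 1 ≤ d 0 := by simpa using hs 0
          simp at h; omega
        rw [hdeq]; constructor
        · exact le_rfl
        · omega
      · rw [if_neg hd1] at hd; exact absurd rfl hd
    · rw [if_neg (by
        intro hmem
        apply hs
        intro t
        fin_cases t
        have : d 0 ≠ 0 := by simpa [Finsupp.mem_support_iff] using hmem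
        simp; omega)] at hd
      exact absurd rfl hd

/-- An admissible matrix of weight `≥ b` vanishes. -/
theorem eq_zero_of_adm {j : ℕ} {Y : Matrix (Fin b) (Fin b) SRing} (hY : Adm π q j Y) (hj : b ≤ j) : Y = 0 := by
  refine Matrix.ext fun i i' => ?_
  rw [Matrix.zero_apply]
  refine MvPolynomial.ext _ _ fun d => ?_
  rw [coeff_zero]
  by_contra hne
  have h := (hY i i' d hne).2
  have hlt : (π i' : ℕ) < b := (π i').isLt
  omega

/-- Entries of an admissible matrix have `s`-degree `≤ ⌊(b-1)/(q+1)⌋`. -/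
theorem totalDegree_le_of_adm {j : ℕ} {Y : Matrix (Fin b) (Fin b) SRing} (hY : Adm π q j Y) (i i' : Fin b) :
    (Y i i').totalDegree ≤ (b - 1) / (q + 1) := by
  rw [MvPolynomial.totalDegree]
  refine Finset.sup_le fun d hd => ?_
  have hne : coeff d (Y i i') ≠ 0 := MvPolynomial.mem_support_iff.1 hd
  obtain ⟨h1, h2⟩ := hY i i' d hne
  have hlt : (π i' : ℕ) < b := (π i').isLt
  have hsum : (d.sum fun _ e => e) = d 0 := by
    rw [Finsupp.sum_fintype _ _ (fun _ => rfl)]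
    simp
  rw [hsum]
  have hq : 0 < q + 1 := Nat.succ_pos q
  refine (Nat.le_div_iff_mul_le hq).2 ?_
  have : d 0 * (q + 1) = d 0 * q + d 0 := by ring
  omega

end Adm

/-! ## §B Uniform `s`-degree of the `u`-coefficients of matrices over `ℂ[s][u]` -/

section DegLE
variable {b : ℕ}

/-- Every `u`-coefficient of every entry has `s`-degree `≤ d`. -/
def DegLE (d : ℕ) (Z : Matrix (Fin b) (Fin b) (Polynomial SRing)) : Prop :=
  ∀ (i j : Fin b) (p : ℕ), (Polynomial.coeff (Z i j) p).totalDegree ≤ d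

/-- `DegLE` is monotone in the degree bound. -/
theorem degLE_mono {d d' : ℕ} {Z : Matrix (Fin b) (Fin b) (Polynomial SRing)} (h : DegLE d Z) (hd : d ≤ d') :
    DegLE d' Z := fun i j p => (h i j p).trans hd

/-- Constants (`cst P`) have `s`-degree `0` in every `u`-coefficient. -/
theorem degLE_cst (P : Matrix (Fin b) (Fin b) ℂ) : DegLE 0 (cst P) := by
  intro i j p
  rw [cst, Matrix.map_apply, Polynomial.coeff_C]
  split_ifs
  · exact (totalDegree_C _).le
  · rw [totalDegree_zero]

/-- `1` has `s`-degree `0` in every `u`-coefficient. -/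
theorem degLE_one : DegLE 0 (1 : Matrix (Fin b) (Fin b) (Polynomial SRing)) := by
  intro i j p
  rw [Matrix.one_apply]
  split_ifs
  · rw [Polynomial.coeff_one]; split_ifs
    · exact (totalDegree_one).le
    · rw [totalDegree_zero]
  · rw [Polynomial.coeff_zero, totalDegree_zero]

/-- `DegLE d` is closed under addition. -/
theorem degLE_add {d : ℕ} {Z Z' : Matrix (Fin b) (Fin b) (Polynomial SRing)} (h : DegLE d Z) (h' : DegLE d Z') :
    DegLE d (Z + Z') := by
  intro i j p
  rw [Matrix.add_apply, Polynomial.coeff_add]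
  exact (totalDegree_add _ _).trans (max_le (h i j p) (h' i j p))

/-- `DegLE d` is closed under finite sums. -/
theorem degLE_sum {d : ℕ} {ι : Type*} (s : Finset ι) (f : ι → Matrix (Fin b) (Fin b) (Polynomial SRing))
    (h : ∀ a ∈ s, DegLE d (f a)) : DegLE d (∑ a ∈ s, f a) := by
  classical
  induction s using Finset.induction_on with
  | empty =>
    intro i j p
    rw [Finset.sum_empty, Matrix.zero_apply, Polynomial.coeff_zero, totalDegree_zero]; exact Nat.zero_le _
  | insert a s ha ih =>
    rw [Finset.sum_insert ha]
    exact degLE_add (h a (Finset.mem_insert_self a s)) (ih fun x hx => h x (Finset.mem_insert_of_mem hx))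

/-- Products: the `s`-degree bounds of the `u`-coefficients add (Cauchy product). -/
theorem degLE_mul {d d' : ℕ} {Z Z' : Matrix (Fin b) (Fin b) (Polynomial SRing)} (h : DegLE d Z) (h' : DegLE d' Z') :
    DegLE (d + d') (Z * Z') := by
  classical
  intro i j p
  rw [Matrix.mul_apply, Polynomial.finsetSum_coeff]
  refine (totalDegree_finsetSum _ _).trans (Finset.sup_le fun l _ => ?_)
  rw [Polynomial.coeff_mul]
  refine (totalDegree_finsetSum _ _).trans (Finset.sup_le fun x _ => ?_)
  exact (totalDegree_mul _ _).trans (add_le_add (h i l x.1) (h' l j x.2))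

/-- Powers: `DegLE d Z → DegLE (k * d) (Z ^ k)`. -/
theorem degLE_pow {d : ℕ} {Z : Matrix (Fin b) (Fin b) (Polynomial SRing)} (h : DegLE d Z) (k : ℕ) :
    DegLE (k * d) (Z ^ k) := by
  induction k with
  | zero => rw [pow_zero, zero_mul]; exact degLE_one
  | succ k ih => rw [pow_succ, Nat.succ_mul]; exact degLE_mul ih h

/-- Multiplying by `u` shifts `u`-coefficients and keeps the `s`-degree bound. -/
theorem degLE_X_mul {d : ℕ} {Z : Matrix (Fin b) (Fin b) (Polynomial SRing)} (h : DegLE d Z) :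
    DegLE d ((Polynomial.X : Polynomial SRing) • Z) := by
  intro i j p
  rw [Matrix.smul_apply, smul_eq_mul]
  cases p with
  | zero => rw [Polynomial.coeff_X_mul_zero, totalDegree_zero]; exact Nat.zero_le _
  | succ p => rw [Polynomial.coeff_X_mul]; exact h i j p

/-- `u^j • (Y.map C)` has `u`-coefficients of `s`-degree `≤ d` if the entries of `Y` have `s`-degree `≤ d`. -/
theorem degLE_X_pow_smul_map_C {d : ℕ} (Y : Matrix (Fin b) (Fin b) SRing) (hY : ∀ i j, (Y i j).totalDegree ≤ d) (k : ℕ) :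
    DegLE d ((Polynomial.X : Polynomial SRing) ^ k • Y.map Polynomial.C) := by
  intro i j p
  rw [Matrix.smul_apply, smul_eq_mul, Matrix.map_apply, mul_comm, Polynomial.coeff_C_mul_X_pow]
  split_ifs
  · exact hY i j
  · rw [totalDegree_zero]; exact Nat.zero_le _

end DegLE

end

end Summit.ValiantsHypothesis.ValiantsHypothesis.Theorems.GrenetZeon.RankRow
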